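import Literature.MathematicalPhysics.QuantumFieldTheory.Balaban1983to89.T3ContinuumUnitLaw
import Literature.MathematicalPhysics.QuantumFieldTheory.Balaban1983to89.T3CentreSymmetry
import Literature.MathematicalPhysics.QuantumFieldTheory.Balaban1983to89.T3LoopLawNondegenerate

/-!
# `Balaban1983to89.T3ContinuumUnitLawNT` — the NON-TRIVIALITY WITNESS (NT3) read on the continuum unit law: under (E3) at
# `ℰ = expMeanLogSUc` the uniform variance lower bound of a label `C` holds (for some constant) iff the continuum unit law gives
# `W_C` positive variance; for a Polyakov label on `SU(2)` iff the doubly-wound smeared Polyakov loop has continuum mean `> −1`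

Cell `ym3-torus` (HUMAN RULING D-0037, YM ladder rung R3), seat `ym3-torus-p2` gen 2 (E3-node holder).  WHAT THIS IS NOT: not d = 4,
not infinite volume, not a mass gap, not Clay, not (E3) and not (NT3): the open content of the fifth conjunct «non-trivial /
non-Gaussian loop laws» (`T3LoopLawNondegenerate`: `UniformVariance` ⇒ `LimitPointsNontrivial` ⇒ non-degenerate, non-Gaussian
limit loop law) is re-expressed, under (E3), as ONE inequality about the continuum unit law `ν` of `T3ContinuumUnitLaw`:
`∫ W_C² dν − (∫ W_C dν)² > 0`; for a Polyakov label (`SU(2)`, centre symmetry `T3CentreSymmetry`: `⟨W̄_P⟩_K = 0`,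
`⟨W̄_P W̄_P⟩_K = (1 + ⟨W̄_{P·P}⟩_K)/2`) it is `∫ W_{P·P} dν > −1` — the continuum unit law does not force every smeared Polyakov
holonomy to square to `−1`.

## Contents

`continuumVariance`; `tendsto_variance_continuumVariance` (the lattice variances converge to it); **`exists_uniformVariance_iff`**
(`(∃ c, UniformVariance S C c) ↔ 0 < continuumVariance`); `integral_polyakov_continuumUnitLaw` (`= 0`),
`continuumVariance_polyakov` (`= (1 + ∫ W_{P·P} dν)/2`), **`exists_uniformVariance_polyakov_iff`** (`↔ −1 < ∫ W_{P·P} dν`),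
`limitPointsNontrivial_of_polyakov_double` (the node's NG conjunct from that inequality).
-/

noncomputable section

open MeasureTheory Filter Topology
open Literature.MathematicalPhysics.QuantumFieldTheory.Balaban1983to89.T3ContinuumYM3Torus
open Literature.MathematicalPhysics.QuantumFieldTheory.Balaban1983to89.T3ThresholdRemoval
open Literature.MathematicalPhysics.QuantumFieldTheory.Balaban1983to89.T3ContinuumUnitLaw
open Literature.MathematicalPhysics.QuantumFieldTheory.Balaban1983to89.Missing
open Literature.MathematicalPhysics.QuantumFieldTheory.Balaban1983to89.T4Continuum

namespace Literature.MathematicalPhysics.QuantumFieldTheory.Balaban1983to89.T3ContinuumUnitLawNT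

variable (F : T3Family) {γ : ℝ} (hγ : 0 ≤ γ) (h : HasContinuumLimit (F.scheme ℰc γ))

/-- The unit-lattice loop variable `W_C(u) = loopAt u (C.atLevel 0)` of a label. [cite: Balaban1987RG1, (0.2) p.252] -/
abbrev W (C : ULoop3 F) (u : GaugeField (F.P 0) 0 (Matrix.specialUnitaryGroup (Fin 2) ℂ)) : ℝ := loopAt u (C.1.atLevel 0)

/-- **THE CONTINUUM VARIANCE** of the label `C`: `∫ W_C² dν − (∫ W_C dν)²` for the continuum unit law `ν`.
[cite: JaffeWittenClay2006, §6.5 p.11] -/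
def continuumVariance (C : ULoop3 F) : ℝ :=
  ∫ u, W F C u * W F C u ∂(continuumUnitLaw F hγ h : Measure (GaugeField (F.P 0) 0 (Matrix.specialUnitaryGroup (Fin 2) ℂ))) -
    (∫ u, W F C u ∂(continuumUnitLaw F hγ h : Measure (GaugeField (F.P 0) 0 (Matrix.specialUnitaryGroup (Fin 2) ℂ)))) ^ 2

/-- The single expectations converge to `∫ W_C dν`. [cite: JaffeWittenClay2006, §6.5 p.11] -/
theorem tendsto_expectAt_single (C : ULoop3 F) :
    Tendsto (fun K => (F.scheme ℰc γ).expectAt K [C]) atTop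
      (𝓝 (∫ u, W F C u ∂(continuumUnitLaw F hγ h : Measure (GaugeField (F.P 0) 0 (Matrix.specialUnitaryGroup (Fin 2) ℂ))))) := by
  have ht := tendsto_expectAt_integral_continuumUnitLaw F hγ h [C]
  simpa [W] using ht

/-- The pair expectations converge to `∫ W_C² dν`. [cite: JaffeWittenClay2006, §6.5 p.11] -/
theorem tendsto_expectAt_pair (C : ULoop3 F) :
    Tendsto (fun K => (F.scheme ℰc γ).expectAt K [C, C]) atTop
      (𝓝 (∫ u, W F C u * W F C u
        ∂(continuumUnitLaw F hγ h : Measure (GaugeField (F.P 0) 0 (Matrix.specialUnitaryGroup (Fin 2) ℂ))))) := by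
  have ht := tendsto_expectAt_integral_continuumUnitLaw F hγ h [C, C]
  simpa [W] using ht

/-- **THE LATTICE VARIANCES CONVERGE TO THE CONTINUUM VARIANCE**: `⟨C,C⟩_K − ⟨C⟩_K² → continuumVariance C`.
[cite: JaffeWittenClay2006, §6.5 p.11] -/
theorem tendsto_variance_continuumVariance (C : ULoop3 F) :
    Tendsto (fun K => (F.scheme ℰc γ).expectAt K [C, C] - (F.scheme ℰc γ).expectAt K [C] ^ 2) atTop
      (𝓝 (continuumVariance F hγ h C)) :=
  (tendsto_expectAt_pair F hγ h C).sub ((tendsto_expectAt_single F hγ h C).pow 2)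

/-- **(NT3) FOR A LABEL ⇔ POSITIVE CONTINUUM VARIANCE** (under (E3), `ℰ = expMeanLogSUc`): the scheme's uniform variance lower
bound `UniformVariance S C c` holds for SOME `c > 0` iff the continuum unit law gives `W_C` positive variance.
[cite: JaffeWittenClay2006, §6.5 p.11] -/
theorem exists_uniformVariance_iff (C : ULoop3 F) :
    (∃ c, UniformVariance (F.scheme ℰc γ) C c) ↔ 0 < continuumVariance F hγ h C := by
  have ht := tendsto_variance_continuumVariance F hγ h C
  constructor
  · rintro ⟨c, hc, hev⟩
    exact lt_of_lt_of_le hc (ge_of_tendsto ht hev)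
  · intro hpos
    refine ⟨continuumVariance F hγ h C / 2, by positivity, ?_⟩
    exact (ht.eventually (eventually_ge_nhds (show continuumVariance F hγ h C / 2 < continuumVariance F hγ h C by linarith))).mono
      fun K hK => hK

/-- **POLYAKOV LOOPS HAVE ZERO CONTINUUM MEAN** (`SU(2)` centre symmetry, `T3CentreSymmetry.expectAt_eq_zero_of_odd_SU2`, in the
limit). [cite: McLerranSvetitsky1981] -/
theorem integral_polyakov_continuumUnitLaw (μ : Fin 3) (x : F.USite) :
    ∫ u, W F (ULoop3.polyakov μ x) u
      ∂(continuumUnitLaw F hγ h : Measure (GaugeField (F.P 0) 0 (Matrix.specialUnitaryGroup (Fin 2) ℂ))) = 0 := by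
  have ht := tendsto_expectAt_single F hγ h (ULoop3.polyakov μ x)
  have h0 : (fun K => (F.scheme ℰc γ).expectAt K [ULoop3.polyakov μ x]) = fun _ => 0 := funext fun K =>
    expectAt_eq_zero_of_odd_SU2 F ℰc γ K (μ := μ) (by rw [List.map_singleton, List.sum_singleton, ULoop3.wind_polyakov]; exact odd_one)
  rw [h0] at ht
  exact tendsto_nhds_unique ht tendsto_const_nhds

/-- **THE CONTINUUM VARIANCE OF A POLYAKOV LABEL** is `(1 + ∫ W_{P·P} dν)/2` (`T3CentreSymmetry.expectAt_pair_eq` in the limit,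
and the vanishing mean). [cite: McLerranSvetitsky1981] -/
theorem continuumVariance_polyakov (μ : Fin 3) (x : F.USite) :
    continuumVariance F hγ h (ULoop3.polyakov μ x) =
      (1 + ∫ u, W F (ULoop3.polyakov μ x).double u
        ∂(continuumUnitLaw F hγ h : Measure (GaugeField (F.P 0) 0 (Matrix.specialUnitaryGroup (Fin 2) ℂ)))) / 2 := by
  have hpair := tendsto_expectAt_pair F hγ h (ULoop3.polyakov μ x)
  have hdouble := tendsto_expectAt_single F hγ h (ULoop3.polyakov μ x).double
  have heq : (fun K => (F.scheme ℰc γ).expectAt K [ULoop3.polyakov μ x, ULoop3.polyakov μ x]) =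
      fun K => (1 + (F.scheme ℰc γ).expectAt K [(ULoop3.polyakov μ x).double]) / 2 :=
    funext fun K => expectAt_pair_eq F measurableE_expMeanLogSUc hγ K _
  rw [heq] at hpair
  have hlim := ((tendsto_const_nhds (x := (1 : ℝ))).add hdouble).div_const 2
  have e1 := tendsto_nhds_unique hpair hlim
  unfold continuumVariance
  rw [e1, integral_polyakov_continuumUnitLaw F hγ h μ x]
  ring

/-- **(NT3) FOR A POLYAKOV LABEL ⇔ `∫ W_{P·P} dν > −1`** (`SU(2)`, under (E3) at `ℰ = expMeanLogSUc`): the non-triviality witness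
of the rung is the statement that the continuum unit law does not make the doubly-wound smeared Polyakov loop identically `−1`
(law form of `T3CentreSymmetry.uniformVariance_polyakov_iff`). [cite: McLerranSvetitsky1981] -/
theorem exists_uniformVariance_polyakov_iff (μ : Fin 3) (x : F.USite) :
    (∃ c, UniformVariance (F.scheme ℰc γ) (ULoop3.polyakov μ x) c) ↔
      -1 < ∫ u, W F (ULoop3.polyakov μ x).double u
        ∂(continuumUnitLaw F hγ h : Measure (GaugeField (F.P 0) 0 (Matrix.specialUnitaryGroup (Fin 2) ℂ))) := by
  rw [exists_uniformVariance_iff F hγ h, continuumVariance_polyakov F hγ h μ x]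
  constructor
  · intro hp
    linarith
  · intro hp
    linarith

/-- Hence the node's NG conjunct `LimitPointsNontrivial` from ONE inequality about the continuum unit law.
[cite: JaffeWittenClay2006, §4 p.6] -/
theorem limitPointsNontrivial_of_polyakov_double (μ : Fin 3) (x : F.USite)
    (hP : -1 < ∫ u, W F (ULoop3.polyakov μ x).double u
      ∂(continuumUnitLaw F hγ h : Measure (GaugeField (F.P 0) 0 (Matrix.specialUnitaryGroup (Fin 2) ℂ)))) :
    LimitPointsNontrivial (F.scheme ℰc γ) := by
  obtain ⟨c, hc⟩ := (exists_uniformVariance_polyakov_iff F hγ h μ x).mpr hP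
  exact limitPointsNontrivial_of_uniformVariance hc

end Literature.MathematicalPhysics.QuantumFieldTheory.Balaban1983to89.T3ContinuumUnitLawNT

end
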